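import Mathlib
import Literature.NumberTheory.LFunctions.Zhang2022.Section14Prop141Twisted
import Literature.NumberTheory.LFunctions.Zhang2022.Section7Eq711Assembly
import HarnessLib

/-!
# Zhang (2022) §14, (14.8), the large-conductor leg `D³ ≤ r < 2DP₄`: the dyadic AGGREGATION
# (per-block large-sieve bound ⇒ `Typed.Sec14.Eq148leg2`)

Topic `Literature/NumberTheory/LFunctions/Zhang2022` (Landau–Siegel audit tree; verdict-neutral).
Y. Zhang, *Discrete mean estimates and the Landau–Siegel zero*, arXiv:2211.02515v1 (2022)
[Zhang2022LandauSiegel] — **an unrefereed manuscript under adjudication; nothing in this file bears on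
its Theorems 1–2 or on Landau–Siegel zeros.** §14 p. 79 (tex L3956–L3963), proof of (14.5) via (14.8):

> "Thus, substituting `Dk = hr`, we see that the left side of (14.8) is
> `≪ Σ_d d⁻¹ Σ_{1<r<2DP₄} Σ_{h<P/r, h≡0(D/(D,r))} D/(φ(hr)h√r) Σ*_{θ mod r, θ≠χ} |Σ_{(l,h)=1} κ*(dl)θ(l)
> Σ_{p∼P} χθ̄(p)Δ(l/(phr))|`. The range for `r` is divided into two parts according to `1 < r < D³` and
> `D³ ≤ r < 2DP₄`. In a way similar to the proof of Proposition 7.1, … for `D³ ≤ r < 2DP₄` we use the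
> Mellin transform, Lemma 5.4 (i) and the large sieve inequality."

"Similar to the proof of Proposition 7.1" means §7 pp. 38–39, (7.15) and §7.u036–u041: on each dyadic
block `R ≤ r < 2R` of moduli the Mellin transform, Lemma 5.4 (i), the two large-sieve bounds and
Cauchy's inequality give `R^{−3/2} Σ_{R≤r<2R} Σ*_θ |𝔰| ≪ τ₅(d)h𝓛ᶜ(R^{1/2}P^{3/2} + R^{−1/2}P²)`
(§7.u041, tree theorems `Section7cCauchyStep.step7u041_holds`, `Section7ExtendedRangeBlocks.step7u041X_first`
for the §7 coefficients). This file proves the BOOKKEEPING that turns such a per-block bound for the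
§14 inner sums into the typed node `Typed.Sec14.Eq148leg2` (the `D³ ≤ r < 2DP₄` part of the u017
majorant `rhs1417On` is `≪ P²D^{−c}`; decl wanted by GAP row G-adj2-4), exactly as
`Section7Eq711Assembly` (`weight713_le`/`fiber713_le`/`blocks713_le`/`sum_bigR_le`) does for (7.13):

* `sum_largeR_le_of_blocks` — the aggregation over an ARBITRARY non-negative inner quantity
  `V d h r` (so that the same theorem serves the β-twisted / (14.6)-variants of the inner sum):
  dyadic cover `R = A·2^i` of `A ≤ r < X`, weight `N/(φ(hr)h√r) ≤ N(1+log P)²/(h²R√R)`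
  (`n/φ(n) ≤ (1+log n)²`, `hr < P`), `Σ_{h<P/R} 1/h ≤ 1 + log⌈P⌉`, `#blocks ≤ log₂X + 1`;
* `eq148leg2_of_blocks` — the instance `N = D`, `A = D³`, `X = ⌈2DP₄⌉`, `V` = the inner
  `Σ*_{θ≠χ}‖…‖` of `rhs1417On`, per-block hypothesis in the FIRST-BOUND form of §7.u041
  (`τ₅(d)h𝓛ᵏ(R^{1/2}P^{3/2} + R^{−1/2}P²)`), and the range arithmetic of p. 79:
  `D·R^{−1/2} ≤ D^{−1/2}` (`R ≥ D³`), `D·R^{1/2}P^{3/2} ≤ P²·D^{3/2}(3t₀)^{1/2}/T ≤ P²D^{−1/2}`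
  (`R ≤ 3DP₄ = 3DPt₀T⁻²`, `T = e^{𝓛^{1.1}} ≥ D²(3t₀)^{1/2}`), `Σ_{d≤2P₄} τ₅(d)/d ≤ M₅(log 2P)⁵`,
  `𝓛ᵐ ≤ K_m D^{1/8}`; conclusion `≤ C·P²·D^{−3/8}`.

Theorems only; 0 new definitions; 0 named facts; the per-block bound is an explicit HYPOTHESIS (it is
the output of the coefficient-generic ports of `Section7cMellinStep`/`Section7cLPolyLargeSieve`/
`Section7cCauchyStep`/`Section7Step7bTruncI` being landed by other seats of the ZHANG-L lane).

## References

* Y. Zhang, arXiv:2211.02515v1 (2022), §14 (14.8) p. 79, tex L3945–L3963; §7 (7.13)–(7.15),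
  §7.u041 pp. 37–39, tex L2005–L2058. [cite: Zhang2022LandauSiegel, §14 (14.8) p. 79]
-/

noncomputable section

open Finset Real

namespace Literature.NumberTheory.LFunctions.Zhang2022.Typed.Sec14

open Literature.NumberTheory.LFunctions.Zhang2022.Skeleton
open Literature.NumberTheory.LFunctions.Zhang2022.Section7cStatements

open scoped Classical

/-! ## Elementary tools -/

/-- The dyadic block of `r ≥ A ≥ 1`: with `i = ⌊log₂(r/A)⌋` and `R = A·2^i`, `R ≤ r < 2R`, i.e.
`r ∈ dyadic R` (`Section7cStatements.dyadic`). [folklore] -/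
private theorem mem_dyadic_mul_two_pow_log {A r : ℕ} (hA : 0 < A) (hAr : A ≤ r) :
    r ∈ dyadic (((A * 2 ^ Nat.log 2 (r / A) : ℕ) : ℝ)) := by
  set i := Nat.log 2 (r / A) with hi
  have hq : r / A ≠ 0 := (Nat.div_pos hAr hA).ne'
  have h1 : A * 2 ^ i ≤ r := by
    have := Nat.pow_log_le_self 2 hq
    calc A * 2 ^ i ≤ A * (r / A) := Nat.mul_le_mul_left _ this
      _ ≤ r := Nat.mul_div_le r A
  have h2 : r < 2 * (A * 2 ^ i) := by
    have := Nat.lt_pow_succ_log_self (b := 2) (by norm_num) (r / A)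
    rw [Nat.div_lt_iff_lt_mul hA, pow_succ] at this
    calc r < 2 ^ i * 2 * A := this
      _ = 2 * (A * 2 ^ i) := by ring
  rw [dyadic, Finset.mem_filter, Finset.mem_range]
  have h1' : ((A * 2 ^ i : ℕ) : ℝ) ≤ r := by exact_mod_cast h1
  have h2' : (r : ℝ) < 2 * ((A * 2 ^ i : ℕ) : ℝ) := by exact_mod_cast h2
  refine ⟨?_, h1', h2'⟩
  rw [Nat.lt_ceil]
  exact h2'

/-- `R^{−3/2} = (R√R)⁻¹` for `R > 0`. [folklore] -/
private theorem rpow_neg_three_halves_eq {R : ℝ} (hR : 0 < R) :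
    R ^ (-(3 / 2 : ℝ)) = (R * Real.sqrt R)⁻¹ := by
  rw [Real.rpow_neg hR.le, show (3 / 2 : ℝ) = 1 + 1 / 2 by norm_num,
    Real.rpow_add hR, Real.rpow_one, Real.sqrt_eq_rpow]

/-- The harmonic bound `Σ_{1≤h<N} 1/h ≤ 1 + log N`. [folklore] -/
private theorem sum_Ico_one_div_le_one_add_log (N : ℕ) :
    ∑ h ∈ Finset.Ico 1 N, (1 : ℝ) / h ≤ 1 + Real.log N := by
  rcases Nat.lt_or_ge N 2 with hN | hN
  · interval_cases N
    · simp
    · simp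
  have hIco : Finset.Ico 1 N = Finset.Icc 1 (N - 1) := by
    ext h; simp only [Finset.mem_Ico, Finset.mem_Icc]; omega
  have h1 : ∑ h ∈ Finset.Icc 1 (N - 1), (1 : ℝ) / h = (harmonic (N - 1) : ℝ) := by
    rw [harmonic_eq_sum_Icc]; push_cast
    exact Finset.sum_congr rfl fun h _ => by rw [one_div]
  rw [hIco, h1]
  have h2 := harmonic_le_one_add_log (N - 1)
  have h3 : Real.log ((N - 1 : ℕ) : ℝ) ≤ Real.log N :=
    Real.log_le_log (by exact_mod_cast (by omega : 0 < N - 1)) (by exact_mod_cast Nat.sub_le N 1)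
  linarith

/-- **The weight of u017 on a dyadic block**: for `1 ≤ h`, `0 < R ≤ r` and `hr ≤ M` (`M ≥ 1`),
`N/(φ(hr)h√r) ≤ N(1 + log M)²/(h²R√R)` (`n/φ(n) ≤ (1 + log n)²`; the §14 twin of
`Section7cStatements.weight713_le`, which is the case `N = 1` with an extra `1/d`).
[cite: Zhang2022LandauSiegel, §14 u017 p.79, tex L3956] -/
theorem weight1417_le {h r : ℕ} {R M N : ℝ} (hN : 0 ≤ N) (hh : 0 < h) (hR : 0 < R)
    (hRr : R ≤ r) (hM : ((h * r : ℕ) : ℝ) ≤ M) (hr : 0 < r) :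
    N / ((Nat.totient (h * r) : ℝ) * h * Real.sqrt r) ≤
      N * (1 + Real.log M) ^ 2 / ((h : ℝ) ^ 2 * (R * Real.sqrt R)) := by
  have hw := weight713_le (d := 1) (h := h) (r := r) (R := R) (M := M) Nat.one_pos hh hR hRr hM hr
  have hφ : 0 < (Nat.totient (h * r) : ℝ) := by exact_mod_cast Nat.totient_pos.mpr (Nat.mul_pos hh hr)
  have hsqr : 0 < Real.sqrt r := Real.sqrt_pos.mpr (by exact_mod_cast hr)
  have heq : N / ((Nat.totient (h * r) : ℝ) * h * Real.sqrt r) =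
      N * (((1 * h : ℕ) : ℝ) * (Nat.totient (h * r) : ℝ) * Real.sqrt r)⁻¹ := by
    rw [div_eq_mul_inv]; push_cast; ring_nf
  rw [heq]
  calc N * (((1 * h : ℕ) : ℝ) * (Nat.totient (h * r) : ℝ) * Real.sqrt r)⁻¹
      ≤ N * ((1 + Real.log M) ^ 2 / (((1 : ℕ) : ℝ) * (h : ℝ) ^ 2 * (R * Real.sqrt R))) :=
        mul_le_mul_of_nonneg_left hw hN
    _ = N * (1 + Real.log M) ^ 2 / ((h : ℝ) ^ 2 * (R * Real.sqrt R)) := by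
        push_cast; ring

/-! ## The generic dyadic aggregation -/

/-- **One dyadic block of `r`, for fixed `d`.** Let `V d h r ≥ 0` be arbitrary, `S ⊆ [2, X)` a set of
moduli, `H(r) ⊆ [1, ⌈P/r⌉)` the admissible `h` for each `r`, and suppose the PER-BLOCK bound
`R^{−3/2} Σ_{r∈dyadic R} V d h r ≤ G(d)·h` for `A ≤ R < X`, `hR < P`. Then the part of
`Σ_{r∈S, r≥A} Σ_{h∈H(r)} N/(φ(hr)h√r)·V d h r` over the block `⌊log₂(r/A)⌋ = i` (`R = A·2^i`) is at most
`N(1+log P)²(1+log⌈P⌉)·G(d)`. [cite: Zhang2022LandauSiegel, §14 u017/(14.8) p.79; §7 (7.15) p.38] -/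
theorem fiber_largeR_le {A X : ℕ} (hA : 0 < A) {P N : ℝ} (hP : 1 ≤ P) (hN : 0 ≤ N)
    (V : ℕ → ℕ → ℕ → ℝ) (hV : ∀ d h r, 0 ≤ V d h r)
    (Hs : ℕ → Finset ℕ) (hHs : ∀ r, Hs r ⊆ Finset.Ico 1 ⌈P / r⌉₊)
    {d : ℕ} {Gd : ℝ} (hGd : 0 ≤ Gd)
    (hblock : ∀ (h : ℕ) (R : ℝ), 0 < h → (A : ℝ) ≤ R → R < X → (h : ℝ) * R < P →
        R ^ (-(3 / 2 : ℝ)) * ∑ r ∈ dyadic R, V d h r ≤ Gd * h)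
    (i : ℕ) :
    ∑ r ∈ ((Finset.Ico 2 X).filter (fun r => ¬ r < A)).filter (fun r => Nat.log 2 (r / A) = i),
        ∑ h ∈ Hs r, N / ((Nat.totient (h * r) : ℝ) * h * Real.sqrt r) * V d h r ≤
      N * (1 + Real.log P) ^ 2 * (1 + Real.log (⌈P⌉₊ : ℕ)) * Gd := by
  set R : ℝ := ((A * 2 ^ i : ℕ) : ℝ) with hR
  set F := ((Finset.Ico 2 X).filter (fun r => ¬ r < A)).filter (fun r => Nat.log 2 (r / A) = i)
    with hF
  set Λ : ℝ := (1 + Real.log P) ^ 2 with hΛ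
  set Hfull : Finset ℕ := Finset.Ico 1 ⌈P / R⌉₊ with hHfull
  have hRpos : 0 < R := by rw [hR]; exact_mod_cast Nat.mul_pos hA (pow_pos two_pos i)
  have hRR : 0 < R * Real.sqrt R := mul_pos hRpos (Real.sqrt_pos.mpr hRpos)
  have hAR : (A : ℝ) ≤ R := by rw [hR]; exact_mod_cast Nat.le_mul_of_pos_right A (pow_pos two_pos i)
  have hP0 : 0 < P := by linarith
  have hΛ0 : 0 ≤ Λ := sq_nonneg _
  have hrhs0 : 0 ≤ N * (1 + Real.log P) ^ 2 * (1 + Real.log (⌈P⌉₊ : ℕ)) * Gd := by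
    have : 0 ≤ 1 + Real.log (⌈P⌉₊ : ℕ) := by
      have := Real.log_natCast_nonneg ⌈P⌉₊; linarith
    positivity
  -- members of the fiber
  have hmem : ∀ r ∈ F, 2 ≤ r ∧ r < X ∧ A ≤ r ∧ r ∈ dyadic R := by
    intro r hr
    rw [hF, Finset.mem_filter, Finset.mem_filter, Finset.mem_Ico] at hr
    obtain ⟨⟨⟨h2, hX⟩, hAr⟩, hlog⟩ := hr
    push Not at hAr
    refine ⟨h2, hX, hAr, ?_⟩
    rw [hR, ← hlog]
    exact mem_dyadic_mul_two_pow_log hA hAr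
  -- the `h`-ranges: `H(r) ⊆ [1, ⌈P/R⌉)` for `r` in the block, and `hR < P` there
  have hHsub : ∀ r ∈ F, Hs r ⊆ Hfull := by
    intro r hr h hh
    obtain ⟨-, -, -, hdy⟩ := hmem r hr
    have hRr : R ≤ r := (Finset.mem_filter.mp hdy).2.1
    have hh' := hHs r hh
    rw [Finset.mem_Ico] at hh' ⊢
    refine ⟨hh'.1, lt_of_lt_of_le hh'.2 (Nat.ceil_mono ?_)⟩
    exact div_le_div_of_nonneg_left hP0.le hRpos hRr
  have hHfull_lt : ∀ h ∈ Hfull, 0 < h ∧ (h : ℝ) * R < P := by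
    intro h hh
    rw [hHfull, Finset.mem_Ico] at hh
    refine ⟨hh.1, ?_⟩
    have h1 : (h : ℝ) ≤ (⌈P / R⌉₊ : ℝ) - 1 := by
      have : h + 1 ≤ ⌈P / R⌉₊ := hh.2
      have : ((h + 1 : ℕ) : ℝ) ≤ (⌈P / R⌉₊ : ℝ) := by exact_mod_cast this
      push_cast at this; linarith
    have h2 : (⌈P / R⌉₊ : ℝ) < P / R + 1 := Nat.ceil_lt_add_one (div_nonneg hP0.le hRpos.le)
    have h3 : (h : ℝ) < P / R := by linarith
    rwa [lt_div_iff₀ hRpos] at h3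
  -- termwise: the weight bound on the block
  have hw : ∀ r ∈ F, ∀ h ∈ Hs r,
      N / ((Nat.totient (h * r) : ℝ) * h * Real.sqrt r) * V d h r ≤
        N * Λ / ((h : ℝ) ^ 2 * (R * Real.sqrt R)) * V d h r := by
    intro r hr h hh
    obtain ⟨h2, -, -, hdy⟩ := hmem r hr
    have hRr : R ≤ r := (Finset.mem_filter.mp hdy).2.1
    have hh' := Finset.mem_Ico.mp (hHs r hh)
    have hr0 : 0 < r := by omega
    -- `h r < P`
    have hM : ((h * r : ℕ) : ℝ) ≤ P := by
      have h1 : (h : ℝ) ≤ (⌈P / r⌉₊ : ℝ) - 1 := by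
        have : ((h + 1 : ℕ) : ℝ) ≤ (⌈P / r⌉₊ : ℝ) := by exact_mod_cast hh'.2
        push_cast at this; linarith
      have hr0' : (0 : ℝ) < r := by exact_mod_cast hr0
      have h2' : (⌈P / r⌉₊ : ℝ) < P / r + 1 := Nat.ceil_lt_add_one (div_nonneg hP0.le hr0'.le)
      have h3 : (h : ℝ) < P / r := by linarith
      rw [lt_div_iff₀ hr0'] at h3
      push_cast; exact h3.le
    exact mul_le_mul_of_nonneg_right (weight1417_le hN hh'.1 hRpos hRr hM hr0) (hV d h r)
  -- the empty fiber is trivial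
  by_cases hne : F = ∅
  · rw [hne, Finset.sum_empty]; exact hrhs0
  obtain ⟨r₀, hr₀⟩ := Finset.nonempty_of_ne_empty hne
  obtain ⟨-, hX₀, -, hdy₀⟩ := hmem r₀ hr₀
  have hRX : R < X := lt_of_le_of_lt (Finset.mem_filter.mp hdy₀).2.1 (by exact_mod_cast hX₀)
  -- the block bound, for each admissible `h`
  have hblk : ∀ h ∈ Hfull, ∑ r ∈ dyadic R, V d h r ≤ R * Real.sqrt R * (Gd * h) := by
    intro h hh
    obtain ⟨hh0, hhR⟩ := hHfull_lt h hh
    have hb := hblock h R hh0 hAR hRX hhR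
    rw [rpow_neg_three_halves_eq hRpos, inv_mul_le_iff₀ hRR] at hb
    exact hb
  have hFsub : F ⊆ dyadic R := fun r hr => (hmem r hr).2.2.2
  -- the harmonic sum over `h < ⌈P/R⌉ ≤ ⌈P⌉`
  have hharm : ∑ h ∈ Hfull, (1 : ℝ) / h ≤ 1 + Real.log (⌈P⌉₊ : ℕ) := by
    refine (sum_Ico_one_div_le_one_add_log ⌈P / R⌉₊).trans ?_
    have hceil : ⌈P / R⌉₊ ≤ ⌈P⌉₊ := by
      refine Nat.ceil_mono ?_
      have hR1 : 1 ≤ R := le_trans (by exact_mod_cast hA) hAR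
      exact div_le_self hP0.le hR1
    rcases Nat.eq_zero_or_pos ⌈P / R⌉₊ with h0 | hpos
    · rw [h0, Nat.cast_zero, Real.log_zero]
      have := Real.log_natCast_nonneg ⌈P⌉₊; linarith
    · have := Real.log_le_log (by exact_mod_cast hpos) (by exact_mod_cast hceil : (⌈P / R⌉₊ : ℝ) ≤ ⌈P⌉₊)
      linarith
  have hlog0 : 0 ≤ 1 + Real.log (⌈P⌉₊ : ℕ) := by
    have := Real.log_natCast_nonneg ⌈P⌉₊; linarith
  calc ∑ r ∈ F, ∑ h ∈ Hs r, N / ((Nat.totient (h * r) : ℝ) * h * Real.sqrt r) * V d h r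
      ≤ ∑ r ∈ F, ∑ h ∈ Hs r, N * Λ / ((h : ℝ) ^ 2 * (R * Real.sqrt R)) * V d h r :=
        Finset.sum_le_sum fun r hr => Finset.sum_le_sum fun h hh => hw r hr h hh
    _ ≤ ∑ r ∈ F, ∑ h ∈ Hfull, N * Λ / ((h : ℝ) ^ 2 * (R * Real.sqrt R)) * V d h r := by
        refine Finset.sum_le_sum fun r hr => ?_
        exact Finset.sum_le_sum_of_subset_of_nonneg (hHsub r hr)
          (fun h _ _ => mul_nonneg (by positivity) (hV d h r))
    _ = ∑ h ∈ Hfull, N * Λ / ((h : ℝ) ^ 2 * (R * Real.sqrt R)) * ∑ r ∈ F, V d h r := by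
        rw [Finset.sum_comm]
        exact Finset.sum_congr rfl fun h _ => by rw [Finset.mul_sum]
    _ ≤ ∑ h ∈ Hfull, N * Λ / ((h : ℝ) ^ 2 * (R * Real.sqrt R)) * ∑ r ∈ dyadic R, V d h r := by
        refine Finset.sum_le_sum fun h _ => mul_le_mul_of_nonneg_left ?_ (by positivity)
        exact Finset.sum_le_sum_of_subset_of_nonneg hFsub (fun r _ _ => hV d h r)
    _ ≤ ∑ h ∈ Hfull, N * Λ / ((h : ℝ) ^ 2 * (R * Real.sqrt R)) * (R * Real.sqrt R * (Gd * h)) :=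
        Finset.sum_le_sum fun h hh => mul_le_mul_of_nonneg_left (hblk h hh) (by positivity)
    _ = ∑ h ∈ Hfull, N * Λ * Gd * ((1 : ℝ) / h) := by
        refine Finset.sum_congr rfl fun h hh => ?_
        have hh0 : (h : ℝ) ≠ 0 := by exact_mod_cast (hHfull_lt h hh).1.ne'
        field_simp
    _ = N * Λ * Gd * ∑ h ∈ Hfull, (1 : ℝ) / h := by rw [Finset.mul_sum]
    _ ≤ N * Λ * Gd * (1 + Real.log (⌈P⌉₊ : ℕ)) :=
        mul_le_mul_of_nonneg_left hharm (by positivity)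
    _ = N * (1 + Real.log P) ^ 2 * (1 + Real.log (⌈P⌉₊ : ℕ)) * Gd := by rw [hΛ]; ring

/-- **All dyadic blocks, all `d`** (the generic aggregation). With `V d h r ≥ 0`, `H(r) ⊆ [1,⌈P/r⌉)`,
and the PER-BLOCK bound `R^{−3/2} Σ_{r∈dyadic R} V d h r ≤ G(d)·h` for `1 ≤ d ≤ d_max`, `h ≥ 1`,
`A ≤ R < X`, `hR < P`:
`Σ_{d≤d_max} d⁻¹ Σ_{A≤r<X} Σ_{h∈H(r)} N/(φ(hr)h√r)·V d h r
   ≤ N(log₂X + 1)(1+log P)²(1+log⌈P⌉) Σ_{d≤d_max} G(d)/d`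
(`#blocks ≤ log₂X + 1`). [cite: Zhang2022LandauSiegel, §14 u017/(14.8) p.79; §7 (7.13)–(7.15) pp.37–38] -/
theorem sum_largeR_le_of_blocks {A X dmax : ℕ} (hA : 0 < A) {P N : ℝ} (hP : 1 ≤ P) (hN : 0 ≤ N)
    (V : ℕ → ℕ → ℕ → ℝ) (hV : ∀ d h r, 0 ≤ V d h r)
    (Hs : ℕ → Finset ℕ) (hHs : ∀ r, Hs r ⊆ Finset.Ico 1 ⌈P / r⌉₊)
    (G : ℕ → ℝ) (hG : ∀ d, 0 ≤ G d)
    (hblock : ∀ (d h : ℕ) (R : ℝ), d ∈ Finset.Icc 1 dmax → 0 < h → (A : ℝ) ≤ R → R < X →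
        (h : ℝ) * R < P → R ^ (-(3 / 2 : ℝ)) * ∑ r ∈ dyadic R, V d h r ≤ G d * h) :
    ∑ d ∈ Finset.Icc 1 dmax, (d : ℝ)⁻¹ * ∑ r ∈ (Finset.Ico 2 X).filter (fun r => ¬ r < A),
        ∑ h ∈ Hs r, N / ((Nat.totient (h * r) : ℝ) * h * Real.sqrt r) * V d h r ≤
      N * ((Nat.log 2 X : ℕ) + 1 : ℝ) * (1 + Real.log P) ^ 2 * (1 + Real.log (⌈P⌉₊ : ℕ)) *
        ∑ d ∈ Finset.Icc 1 dmax, G d / d := by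
  set S := (Finset.Ico 2 X).filter (fun r => ¬ r < A) with hS
  set I : ℕ := Nat.log 2 X with hI
  set K : ℝ := N * (1 + Real.log P) ^ 2 * (1 + Real.log (⌈P⌉₊ : ℕ)) with hK
  have hlog0 : 0 ≤ 1 + Real.log (⌈P⌉₊ : ℕ) := by
    have := Real.log_natCast_nonneg ⌈P⌉₊; linarith
  have hK0 : 0 ≤ K := by rw [hK]; positivity
  -- every `r ∈ S` falls in a block `i ≤ I`
  have hmaps : ∀ r ∈ S, Nat.log 2 (r / A) ∈ Finset.range (I + 1) := by
    intro r hr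
    rw [hS, Finset.mem_filter, Finset.mem_Ico] at hr
    rw [Finset.mem_range, Nat.lt_succ_iff, hI]
    exact Nat.log_mono_right (le_trans (Nat.div_le_self r A) hr.1.2.le)
  -- the bound for each `d`
  have hd : ∀ d ∈ Finset.Icc 1 dmax,
      ∑ r ∈ S, ∑ h ∈ Hs r, N / ((Nat.totient (h * r) : ℝ) * h * Real.sqrt r) * V d h r ≤
        ((I : ℕ) + 1 : ℝ) * (K * G d) := by
    intro d hdm
    rw [← Finset.sum_fiberwise_of_maps_to hmaps]
    have hfib : ∀ i ∈ Finset.range (I + 1),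
        ∑ r ∈ S.filter (fun r => Nat.log 2 (r / A) = i),
          ∑ h ∈ Hs r, N / ((Nat.totient (h * r) : ℝ) * h * Real.sqrt r) * V d h r ≤ K * G d := by
      intro i _
      have h := fiber_largeR_le hA hP hN V hV Hs hHs (d := d) (hG d)
        (fun h R hh hAR hRX hhR => hblock d h R hdm hh hAR hRX hhR) i
      rw [hK]
      exact h
    refine (Finset.sum_le_sum hfib).trans ?_
    rw [Finset.sum_const, Finset.card_range, nsmul_eq_mul]
    push_cast
    rfl
  calc ∑ d ∈ Finset.Icc 1 dmax, (d : ℝ)⁻¹ *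
        ∑ r ∈ S, ∑ h ∈ Hs r, N / ((Nat.totient (h * r) : ℝ) * h * Real.sqrt r) * V d h r
      ≤ ∑ d ∈ Finset.Icc 1 dmax, (d : ℝ)⁻¹ * (((I : ℕ) + 1 : ℝ) * (K * G d)) :=
        Finset.sum_le_sum fun d hdm =>
          mul_le_mul_of_nonneg_left (hd d hdm) (inv_nonneg.mpr (Nat.cast_nonneg d))
    _ = N * ((I : ℕ) + 1 : ℝ) * (1 + Real.log P) ^ 2 * (1 + Real.log (⌈P⌉₊ : ℕ)) *
          ∑ d ∈ Finset.Icc 1 dmax, G d / d := by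
        rw [hK, Finset.mul_sum]
        exact Finset.sum_congr rfl fun d _ => by rw [div_eq_mul_inv]; ring

/-! ## The ranges of §14 p. 79: `P₄ = PT⁻²t₀`, `T = e^{𝓛^{1.1}}`, `D³ ≤ R ≤ 3DP₄` -/

/-- `𝓛ᵐ ≤ K_m·D^{1/8}` for `D ≥ 1` (`𝓛 = log D ≤ D^ε/ε`, `ε = 1/(8(m+1))`). [folklore] -/
private theorem ell_pow_le_mul_rpow_eighth (m : ℕ) :
    ∃ K : ℝ, 0 < K ∧ ∀ D : ℕ, 1 ≤ D → ell D ^ m ≤ K * (D : ℝ) ^ (1 / 8 : ℝ) := by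
  set ε : ℝ := 1 / (8 * ((m : ℝ) + 1)) with hε
  have hm1 : (0 : ℝ) < (m : ℝ) + 1 := by positivity
  have hε0 : 0 < ε := by rw [hε]; positivity
  refine ⟨ε⁻¹ ^ m, by positivity, fun D hD => ?_⟩
  have hD0 : (0 : ℝ) ≤ D := Nat.cast_nonneg D
  have hD1 : (1 : ℝ) ≤ D := by exact_mod_cast hD
  have hlog : ell D ≤ (D : ℝ) ^ ε / ε := by
    rw [ell]; exact Real.log_le_rpow_div hD0 hε0
  have hℓ0 : 0 ≤ ell D := by rw [ell]; exact Real.log_nonneg hD1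
  calc ell D ^ m ≤ ((D : ℝ) ^ ε / ε) ^ m := pow_le_pow_left₀ hℓ0 hlog m
    _ = ε⁻¹ ^ m * (D : ℝ) ^ (ε * m) := by
        rw [div_eq_mul_inv, mul_pow, mul_comm, ← Real.rpow_natCast ((D : ℝ) ^ ε) m,
          ← Real.rpow_mul hD0]
    _ ≤ ε⁻¹ ^ m * (D : ℝ) ^ (1 / 8 : ℝ) := by
        refine mul_le_mul_of_nonneg_left (Real.rpow_le_rpow_of_exponent_le hD1 ?_) (by positivity)
        rw [hε, div_mul_eq_mul_div, one_mul, div_le_div_iff₀ (by positivity) (by norm_num)]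
        nlinarith

/-- **`D²(3t₀)^{1/2} ≤ T` for all large `D`** (`D = e^{𝓛}`, `t₀ = 𝓛⁵¹⁹`, `T = e^{𝓛^{1.1}}`): for
`𝓛 ≥ 3¹⁰` one has `𝓛^{0.1} ≥ 3`, so `T ≥ D³`, while `(3t₀)^{1/2} ≤ 3𝓛⁵¹⁹ ≤ D` once `𝓛 ≥ 3·520!`.
[cite: Zhang2022LandauSiegel, §2 pp. 4–5 (the parameters `P`, `T`, `t₀`)] -/
theorem sq_mul_sqrt_three_t0_le_bigT :
    ∃ D₀ : ℕ, ∀ D : ℕ, D₀ ≤ D → (D : ℝ) ^ 2 * Real.sqrt (3 * t0 D) ≤ bigT D := by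
  obtain ⟨D₀, hD₀⟩ := exists_nat_forall_le_ell (max ((3 : ℝ) ^ 10) (3 * (Nat.factorial 520 : ℝ)))
  refine ⟨max 1 D₀, fun D hD => ?_⟩
  have hD1 : 1 ≤ D := le_trans (le_max_left _ _) hD
  have hℓ := hD₀ D (le_trans (le_max_right _ _) hD)
  have hℓ310 : (3 : ℝ) ^ 10 ≤ ell D := le_trans (le_max_left _ _) hℓ
  have hℓfac : 3 * (Nat.factorial 520 : ℝ) ≤ ell D := le_trans (le_max_right _ _) hℓ
  have hℓ1 : 1 ≤ ell D := le_trans (by norm_num) hℓ310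
  have hℓ0 : 0 < ell D := by linarith
  have hDexp : (D : ℝ) = Real.exp (ell D) := by
    rw [ell, Real.exp_log (by exact_mod_cast hD1)]
  -- `𝓛^{0.1} ≥ 3`, hence `𝓛^{1.1} ≥ 3𝓛` and `T ≥ D³`
  have h01 : (3 : ℝ) ≤ ell D ^ (0.1 : ℝ) := by
    have h3 : (3 : ℝ) = ((3 : ℝ) ^ 10) ^ (0.1 : ℝ) := by
      rw [← Real.rpow_natCast (3 : ℝ) 10, ← Real.rpow_mul (by norm_num)]; norm_num
    rw [h3]
    exact Real.rpow_le_rpow (by positivity) hℓ310 (by norm_num)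
  have h11 : 3 * ell D ≤ ell D ^ (1.1 : ℝ) := by
    rw [show (1.1 : ℝ) = 1 + 0.1 by norm_num, Real.rpow_add hℓ0, Real.rpow_one]
    nlinarith
  have hT : Real.exp (ell D) ^ 3 ≤ bigT D := by
    rw [bigT, ← Real.exp_nat_mul]
    exact Real.exp_le_exp.mpr (by push_cast; linarith)
  -- `(3t₀)^{1/2} ≤ 3t₀ ≤ e^{𝓛}`
  have ht0 : (1 : ℝ) ≤ 3 * t0 D := by
    rw [t0]; nlinarith [one_le_pow₀ (n := 519) hℓ1]
  have hsqrt : Real.sqrt (3 * t0 D) ≤ 3 * t0 D := by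
    rw [Real.sqrt_le_left (by linarith)]
    nlinarith
  have h519 : 3 * t0 D ≤ Real.exp (ell D) := by
    rw [t0]
    have h1 : ell D ^ 520 ≤ (Nat.factorial 520 : ℝ) * Real.exp (ell D) := by
      have := Real.pow_div_factorial_le_exp (ell D) hℓ0.le 520
      rwa [div_le_iff₀ (by exact_mod_cast Nat.factorial_pos _), mul_comm] at this
    have h2 : 3 * ell D ^ 519 * ell D ≤ Real.exp (ell D) * ell D := by
      calc 3 * ell D ^ 519 * ell D = 3 * ell D ^ 520 := by ring
        _ ≤ 3 * ((Nat.factorial 520 : ℝ) * Real.exp (ell D)) := by linarith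
        _ = (3 * (Nat.factorial 520 : ℝ)) * Real.exp (ell D) := by ring
        _ ≤ ell D * Real.exp (ell D) := mul_le_mul_of_nonneg_right hℓfac (Real.exp_pos _).le
        _ = Real.exp (ell D) * ell D := mul_comm _ _
    exact le_of_mul_le_mul_right h2 hℓ0
  calc (D : ℝ) ^ 2 * Real.sqrt (3 * t0 D) ≤ (D : ℝ) ^ 2 * Real.exp (ell D) :=
        mul_le_mul_of_nonneg_left (hsqrt.trans h519) (by positivity)
    _ = Real.exp (ell D) ^ 3 := by rw [hDexp]; ring
    _ ≤ bigT D := hT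

/-- `P₄ ≥ 1` for `𝓛 ≥ 3` (`P₄ = e^{𝓛⁹}e^{−2𝓛^{1.1}}𝓛⁵¹⁹`; as `Section6HorizontalSides.one_le_P4`).
[cite: Zhang2022LandauSiegel, §6 p.30] -/
theorem one_le_P4_of_three_le {D : ℕ} (hL : 3 ≤ ell D) : 1 ≤ P4 D := by
  have hL1 : 1 ≤ ell D := by linarith
  have hL0 : 0 < ell D := by linarith
  have h11 : ell D ^ (1.1 : ℝ) ≤ ell D ^ 2 := by
    have := Real.rpow_le_rpow_of_exponent_le hL1 (by norm_num : (1.1 : ℝ) ≤ 2)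
    rwa [Real.rpow_two] at this
  have h22 : 2 * ell D ^ 2 ≤ ell D ^ 9 := by
    have h39 : ell D ^ 3 ≤ ell D ^ 9 := pow_le_pow_right₀ hL1 (by norm_num)
    have : ell D ^ 3 = ell D * ell D ^ 2 := by ring
    nlinarith [pow_pos hL0 2]
  have hexp : bigT D ^ 2 ≤ bigP D := by
    rw [bigT, bigP, ← Real.exp_nat_mul]
    exact Real.exp_le_exp.mpr (by push_cast; linarith)
  have h519 : (1 : ℝ) ≤ t0 D := by rw [t0]; exact one_le_pow₀ hL1
  have hT2 : 0 < bigT D ^ 2 := pow_pos (Real.exp_pos _) 2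
  rw [P4]
  exact one_le_mul_of_one_le_of_one_le ((one_le_div hT2).mpr hexp) h519

/-- **The two range estimates of the large-`r` leg** (§14 p. 79; cf. §7 p. 39 "`R^{1/2}P^{3/2} +
R^{−1/2}P² ≪ P²D^{−c}`"): once `D²(3t₀)^{1/2} ≤ T` and `𝓛 ≥ 3`, for `D³ ≤ R ≤ 3DP₄`
`D·(R^{1/2}P^{3/2} + R^{−1/2}P²) ≤ 2P²D^{−1/2}` (`3DP₄ = 3DPt₀/T²`), and `2DP₄ ≤ P`.
[cite: Zhang2022LandauSiegel, §14 (14.8) p.79, tex L3962] -/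
theorem largeR_range_le {D : ℕ} (hL : 3 ≤ ell D) (hT : (D : ℝ) ^ 2 * Real.sqrt (3 * t0 D) ≤ bigT D) :
    (D : ℝ) * ((3 * (D : ℝ) * P4 D) ^ (1 / 2 : ℝ) * bigP D ^ (3 / 2 : ℝ) +
        ((D : ℝ) ^ 3) ^ (-(1 / 2 : ℝ)) * bigP D ^ 2) ≤
      2 * bigP D ^ 2 * (D : ℝ) ^ (-(1 / 2 : ℝ)) ∧ 2 * (D : ℝ) * P4 D ≤ bigP D := by
  have hL1 : 1 ≤ ell D := by linarith
  have hD1 : (1 : ℝ) < D := by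
    have h : Real.exp 1 ≤ Real.exp (ell D) := Real.exp_le_exp.mpr hL1
    have hD0 : (0 : ℝ) < D := by
      by_contra h0
      push Not at h0
      have : ell D ≤ 0 := by
        rw [ell]
        rcases h0.eq_or_lt with h00 | hneg
        · rw [h00, Real.log_zero]
        · exact (Real.log_nonpos (by linarith) (by linarith))
      linarith
    rw [ell, Real.exp_log hD0] at h
    linarith [Real.add_one_le_exp (1 : ℝ)]
  have hD0 : (0 : ℝ) < D := by linarith
  have hP0 : 0 < bigP D := Real.exp_pos _
  have hT0 : 0 < bigT D := Real.exp_pos _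
  have ht0 : (1 : ℝ) ≤ 3 * t0 D := by rw [t0]; nlinarith [one_le_pow₀ (n := 519) hL1]
  have hsD : 0 < Real.sqrt D := Real.sqrt_pos.mpr hD0
  -- `D^{-1/2} = 1/√D`
  have hDneg : (D : ℝ) ^ (-(1 / 2 : ℝ)) = (Real.sqrt D)⁻¹ := by
    rw [Real.rpow_neg hD0.le, Real.sqrt_eq_rpow]
  -- second term: `D·R^{-1/2}·P² ≤ P²/√D` from `R ≥ D³`
  have h2 : (D : ℝ) * (((D : ℝ) ^ 3) ^ (-(1 / 2 : ℝ)) * bigP D ^ 2) = bigP D ^ 2 * (D : ℝ) ^ (-(1 / 2 : ℝ)) := by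
    have hD3 : ((D : ℝ) ^ 3) ^ (-(1 / 2 : ℝ)) = ((D : ℝ) * Real.sqrt D)⁻¹ := by
      rw [Real.rpow_neg (by positivity), ← Real.sqrt_eq_rpow,
        show (D : ℝ) ^ 3 = (D : ℝ) ^ 2 * D by ring, Real.sqrt_mul (by positivity), Real.sqrt_sq hD0.le]
    rw [hD3, hDneg]
    field_simp
  -- first term: `D·R^{1/2}·P^{3/2} ≤ D·(3DP₄)^{1/2}P^{3/2} = P²·D^{3/2}(3t₀)^{1/2}/T ≤ P²/√D`
  have h1 : (D : ℝ) * ((3 * (D : ℝ) * P4 D) ^ (1 / 2 : ℝ) * bigP D ^ (3 / 2 : ℝ)) ≤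
      bigP D ^ 2 * (D : ℝ) ^ (-(1 / 2 : ℝ)) := by
    have hP32 : bigP D ^ (3 / 2 : ℝ) = bigP D * Real.sqrt (bigP D) := by
      rw [show (3 / 2 : ℝ) = 1 + 1 / 2 by norm_num, Real.rpow_add hP0, Real.rpow_one, Real.sqrt_eq_rpow]
    -- `(3DP₄)^{1/2}·√P = P·√(3Dt₀)/T`
    have hkey : (3 * (D : ℝ) * P4 D) ^ (1 / 2 : ℝ) * Real.sqrt (bigP D) =
        bigP D * Real.sqrt (3 * t0 D) * Real.sqrt D / bigT D := by
      have hP40 : 0 ≤ 3 * (D : ℝ) * P4 D :=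
        mul_nonneg (by positivity) (zero_le_one.trans (one_le_P4_of_three_le hL))
      rw [← Real.sqrt_eq_rpow, ← Real.sqrt_mul hP40]
      have : 3 * (D : ℝ) * P4 D * bigP D = (bigP D * Real.sqrt (3 * t0 D) * Real.sqrt D / bigT D) ^ 2 := by
        rw [P4, div_pow, mul_pow, mul_pow, Real.sq_sqrt (by linarith), Real.sq_sqrt hD0.le]
        field_simp
      rw [this, Real.sqrt_sq (by positivity)]
    have hmain : (D : ℝ) * ((3 * (D : ℝ) * P4 D) ^ (1 / 2 : ℝ) * bigP D ^ (3 / 2 : ℝ)) =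
        bigP D ^ 2 * ((D : ℝ) * Real.sqrt D * Real.sqrt (3 * t0 D) / bigT D) := by
      rw [hP32, show (3 * (D : ℝ) * P4 D) ^ (1 / 2 : ℝ) * (bigP D * Real.sqrt (bigP D)) =
        bigP D * ((3 * (D : ℝ) * P4 D) ^ (1 / 2 : ℝ) * Real.sqrt (bigP D)) by ring, hkey]
      field_simp
    -- `D√D·√(3t₀)/T ≤ 1/√D` from `D²√(3t₀) ≤ T`
    have hfrac : (D : ℝ) * Real.sqrt D * Real.sqrt (3 * t0 D) / bigT D ≤ (Real.sqrt D)⁻¹ := by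
      rw [div_le_iff₀ hT0, inv_mul_eq_div, le_div_iff₀ hsD]
      calc (D : ℝ) * Real.sqrt D * Real.sqrt (3 * t0 D) * Real.sqrt D
          = (D : ℝ) * (Real.sqrt D * Real.sqrt D) * Real.sqrt (3 * t0 D) := by ring
        _ = (D : ℝ) ^ 2 * Real.sqrt (3 * t0 D) := by rw [Real.mul_self_sqrt hD0.le]; ring
        _ ≤ bigT D := hT
    calc (D : ℝ) * ((3 * (D : ℝ) * P4 D) ^ (1 / 2 : ℝ) * bigP D ^ (3 / 2 : ℝ))
        = bigP D ^ 2 * ((D : ℝ) * Real.sqrt D * Real.sqrt (3 * t0 D) / bigT D) := hmain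
      _ ≤ bigP D ^ 2 * (Real.sqrt D)⁻¹ := mul_le_mul_of_nonneg_left hfrac (by positivity)
      _ = bigP D ^ 2 * (D : ℝ) ^ (-(1 / 2 : ℝ)) := by rw [hDneg]
  refine ⟨by rw [mul_add]; linarith, ?_⟩
  -- `2DP₄ = 2DPt₀/T² ≤ P` from `T² ≥ T ≥ D²√(3t₀) ≥ 2Dt₀`? use `T ≥ D²·√(3t₀)` twice: `T² ≥ D⁴·3t₀ ≥ 2Dt₀`.
  have hT2 : 2 * (D : ℝ) * t0 D ≤ bigT D ^ 2 := by
    have h3 : (D : ℝ) ^ 4 * (3 * t0 D) ≤ bigT D ^ 2 := by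
      calc (D : ℝ) ^ 4 * (3 * t0 D) = ((D : ℝ) ^ 2 * Real.sqrt (3 * t0 D)) ^ 2 := by
            rw [mul_pow, Real.sq_sqrt (by linarith)]; ring
        _ ≤ bigT D ^ 2 := pow_le_pow_left₀ (by positivity) hT 2
    have hD4 : (D : ℝ) ≤ (D : ℝ) ^ 4 := by
      calc (D : ℝ) = (D : ℝ) ^ 1 := (pow_one _).symm
        _ ≤ (D : ℝ) ^ 4 := pow_le_pow_right₀ hD1.le (by norm_num)
    have ht00 : 0 ≤ t0 D := by rw [t0]; positivity
    nlinarith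
  rw [P4]
  calc 2 * (D : ℝ) * (bigP D / bigT D ^ 2 * t0 D) = bigP D * (2 * (D : ℝ) * t0 D) / bigT D ^ 2 := by ring
    _ ≤ bigP D * bigT D ^ 2 / bigT D ^ 2 := by gcongr
    _ = bigP D := by field_simp

/-- `log(2P) ≤ 2𝓛⁹` and friends: for `𝓛 ≥ 1`, `log 2 + 𝓛⁹ ≤ 2𝓛⁹`. [folklore] -/
private theorem log_two_mul_bigP_le {D : ℕ} (hL : 1 ≤ ell D) : Real.log (2 * bigP D) ≤ 2 * ell D ^ 9 := by
  have h9 : 1 ≤ ell D ^ 9 := one_le_pow₀ hL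
  rw [bigP, Real.log_mul (by norm_num) (Real.exp_pos _).ne', Real.log_exp]
  have := Real.log_two_lt_d9; norm_num at this; linarith

/-! ## The assembly: per-block bounds ⇒ `Eq148leg2` -/

set_option maxHeartbeats 400000 in -- one long bookkeeping assembly (dyadic blocks × logs × divisor sums)
/-- **The large-`r` leg for one `D`, from per-block bounds (generic inner quantity).** Let `V d h r ≥ 0`
(in the applications: the sum over the primitive `θ (mod r)` with `θχ` non-principal of
`|Σ_{(l,h)=1} κ*(dl)θ(l)Σ_{p∼P}χθ̄(p)[(pt₀)^β]Δ(l/(phr))|`), `H(r) ⊆ [1,⌈P/r⌉)`, `1 ≤ X ≤ 2DP₄ + 1`, and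
suppose the §7.u041-type PER-BLOCK bound `R^{−3/2}Σ_{r∈dyadic R} V d h r ≤ C·τ₅(d)·h·𝓛ᵏ·(R^{1/2}P^{3/2} +
R^{−1/2}P²)` for `1 ≤ d ≤ 2P₄`, `h ≥ 1`, `D³ ≤ R ≤ 3DP₄`, `hR < P`. If `𝓛 ≥ 3`, `D²(3t₀)^{1/2} ≤ T` and
`𝓛^{k+81} ≤ K·D^{1/8}`, then
`Σ_{d≤2P₄} d⁻¹ Σ_{D³≤r<X} Σ_{h∈H(r)} D/(φ(hr)h√r)·V d h r ≤ 3840·C⁺·M₅·K·P²·D^{−3/8}` (`C⁺ = max(C,0)`,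
`M₅ = majorantConst 5 5`): `≤ 5𝓛⁹` blocks, weight `≤ D(1+𝓛⁹)²/(h²R√R)`, `Σ_h 1/h ≤ 3𝓛⁹`,
`Σ_d τ₅(d)/d ≤ 32M₅𝓛⁴⁵`, `D(R^{1/2}P^{3/2} + R^{−1/2}P²) ≤ 2P²D^{−1/2}`.
[cite: Zhang2022LandauSiegel, §14 (14.8) p.79, tex L3956–L3963] -/
theorem largeR_sum_le_of_blocks {D : ℕ} (hL3 : 3 ≤ ell D)
    (hT : (D : ℝ) ^ 2 * Real.sqrt (3 * t0 D) ≤ bigT D) {k : ℕ} {K : ℝ}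
    (hKD : ell D ^ (k + 81) ≤ K * (D : ℝ) ^ (1 / 8 : ℝ)) {C : ℝ}
    (V : ℕ → ℕ → ℕ → ℝ) (hV0 : ∀ d h r, 0 ≤ V d h r) {X : ℕ} (hX1 : 1 ≤ X)
    (hXle : (X : ℝ) ≤ 2 * (D : ℝ) * P4 D + 1)
    (Hs : ℕ → Finset ℕ) (hHsub : ∀ r, Hs r ⊆ Finset.Ico 1 ⌈bigP D / r⌉₊)
    (hblk : ∀ (d h : ℕ) (R : ℝ), 0 < d → (d : ℝ) ≤ 2 * P4 D → 0 < h →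
        (D : ℝ) ^ 3 ≤ R → R ≤ 3 * (D : ℝ) * P4 D → (h : ℝ) * R < bigP D →
        R ^ (-(3 / 2 : ℝ)) * ∑ r ∈ dyadic R, V d h r ≤
          C * MeanSquareMajorant.tau 5 d * h * ell D ^ k *
            (R ^ (1 / 2 : ℝ) * bigP D ^ (3 / 2 : ℝ) + R ^ (-(1 / 2 : ℝ)) * bigP D ^ 2)) :
    ∑ d ∈ Finset.Icc 1 ⌊2 * P4 D⌋₊, (d : ℝ)⁻¹ *
        ∑ r ∈ (Finset.Ico 2 X).filter (fun r => ¬ r < D ^ 3),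
          ∑ h ∈ Hs r, (D : ℝ) / ((Nat.totient (h * r) : ℝ) * h * Real.sqrt r) * V d h r ≤
      3840 * max C 0 * MeanSquareMajorant.majorantConst 5 5 * K * bigP D ^ 2 *
        (D : ℝ) ^ (-(3 / 8 : ℝ)) := by
  set M₅ : ℝ := MeanSquareMajorant.majorantConst 5 5 with hM₅
  have hM₅0 : 0 < M₅ := MeanSquareMajorant.majorantConst_pos 5 5
  set Cp : ℝ := max C 0 with hCp
  have hCp0 : 0 ≤ Cp := le_max_right _ _
  have hCCp : C ≤ Cp := le_max_left _ _
  have hL1 : 1 ≤ ell D := by linarith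
  have hL0 : 0 ≤ ell D := by linarith
  -- sizes
  have hD1nat : 1 ≤ D := by
    by_contra h0
    push Not at h0
    have : D = 0 := by omega
    have : ell D = 0 := by rw [ell, this, Nat.cast_zero, Real.log_zero]
    linarith
  have hD1 : (1 : ℝ) ≤ D := by exact_mod_cast hD1nat
  have hD0 : (0 : ℝ) < D := by linarith
  obtain ⟨hDY, h2DP4⟩ := largeR_range_le hL3 hT
  set P : ℝ := bigP D with hPdef
  have hP1 : 1 ≤ P := by rw [hPdef, bigP]; exact Real.one_le_exp (by positivity)
  have hP0 : 0 < P := by linarith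
  have hP41 : 1 ≤ P4 D := one_le_P4_of_three_le hL3
  have hP40 : 0 ≤ P4 D := by linarith
  have hDP4 : (1 : ℝ) ≤ (D : ℝ) * P4 D := one_le_mul_of_one_le_of_one_le hD1 hP41
  -- the data of the generic aggregation
  set dmax : ℕ := ⌊2 * P4 D⌋₊ with hdmax
  set Y : ℝ := (3 * (D : ℝ) * P4 D) ^ (1 / 2 : ℝ) * P ^ (3 / 2 : ℝ) +
    ((D : ℝ) ^ 3) ^ (-(1 / 2 : ℝ)) * P ^ 2 with hY
  have hY0 : 0 ≤ Y := by positivity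
  have hDY' : (D : ℝ) * Y ≤ 2 * P ^ 2 * (D : ℝ) ^ (-(1 / 2 : ℝ)) := hDY
  set G : ℕ → ℝ := fun d => Cp * MeanSquareMajorant.tau 5 d * ell D ^ k * Y with hG
  have hG0 : ∀ d, 0 ≤ G d := fun d => by
    have := MeanSquareMajorant.tau_nonneg 5 d
    positivity
  have hHsub' : ∀ r, Hs r ⊆ Finset.Ico 1 ⌈P / r⌉₊ := hHsub
  have hA0 : 0 < D ^ 3 := pow_pos (by omega) 3
  -- elementary sums and logs, all in terms of `L9 = 𝓛⁹`
  set L9 : ℝ := ell D ^ 9 with hL9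
  have hL9one : 1 ≤ L9 := one_le_pow₀ hL1
  have hL9pos : 0 < L9 := by linarith
  have hellk : 0 ≤ ell D ^ k := pow_nonneg hL0 k
  have hlogP : Real.log P = L9 := by rw [hPdef, bigP, Real.log_exp]
  have hlog2P : Real.log (2 * P) ≤ 2 * L9 := log_two_mul_bigP_le hL1
  -- `X ≤ 2P`, `dmax + 1 ≤ 2P`, `⌈P⌉ ≤ 2P`
  have hX2P : (X : ℝ) ≤ 2 * P := by linarith
  have hdmax2 : 2 ≤ dmax := Nat.le_floor (by push_cast; linarith)
  have hdmax2P : ((dmax + 1 : ℕ) : ℝ) ≤ 2 * P := by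
    have h1 : (dmax : ℝ) ≤ 2 * P4 D := Nat.floor_le (by positivity)
    have h2 : 2 * P4 D ≤ 2 * (D : ℝ) * P4 D := by nlinarith
    push_cast; linarith
  have hceilP : ((⌈P⌉₊ : ℕ) : ℝ) ≤ 2 * P := by
    have h1 : ((⌈P⌉₊ : ℕ) : ℝ) < P + 1 := Nat.ceil_lt_add_one hP0.le
    linarith
  -- T1: number of blocks
  have hT1 : ((Nat.log 2 X : ℕ) + 1 : ℝ) ≤ 5 * L9 := by
    have h2I : ((2 : ℕ) ^ Nat.log 2 X : ℕ) ≤ X := Nat.pow_log_le_self 2 (by omega)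
    have h2I' : (2 : ℝ) ^ (Nat.log 2 X) ≤ X := by exact_mod_cast h2I
    have hlog2 : (Nat.log 2 X : ℝ) * Real.log 2 ≤ Real.log X := by
      rw [← Real.log_pow]
      exact Real.log_le_log (by positivity) h2I'
    have hlogX : Real.log X ≤ 2 * L9 :=
      (Real.log_le_log (by exact_mod_cast hX1) hX2P).trans hlog2P
    have hl2 : (1 / 2 : ℝ) < Real.log 2 := by have := Real.log_two_gt_d9; norm_num at this; linarith
    have : (Nat.log 2 X : ℝ) ≤ 4 * L9 := by
      have hI0 : (0 : ℝ) ≤ Nat.log 2 X := Nat.cast_nonneg _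
      have h3 := mul_le_mul_of_nonneg_left hl2.le hI0
      linarith
    linarith
  -- T2, T3
  have hT2 : (1 + Real.log P) ^ 2 ≤ 4 * L9 ^ 2 := by rw [hlogP]; nlinarith
  have hT3 : 1 + Real.log ((⌈P⌉₊ : ℕ) : ℝ) ≤ 3 * L9 := by
    have : Real.log ((⌈P⌉₊ : ℕ) : ℝ) ≤ Real.log (2 * P) :=
      Real.log_le_log (by exact_mod_cast Nat.ceil_pos.mpr hP0) hceilP
    linarith
  -- T4: the divisor sum
  have hT4 : ∑ d ∈ Finset.Icc 1 dmax, MeanSquareMajorant.tau 5 d / d ≤ 32 * M₅ * L9 ^ 5 := by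
    have hIcc : Finset.Icc 1 dmax = Finset.Ico 1 (dmax + 1) := by
      ext d; simp only [Finset.mem_Icc, Finset.mem_Ico]; omega
    rw [hIcc]
    refine (Section7cStatements.sum_Ico_tau_five_div_le (by omega)).trans ?_
    have hlog : Real.log ((dmax + 1 : ℕ) : ℝ) ≤ 2 * L9 :=
      (Real.log_le_log (by positivity) hdmax2P).trans hlog2P
    have hlog0 : 0 ≤ Real.log ((dmax + 1 : ℕ) : ℝ) := Real.log_natCast_nonneg _
    calc M₅ * Real.log ((dmax + 1 : ℕ) : ℝ) ^ 5 ≤ M₅ * (2 * L9) ^ 5 :=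
          mul_le_mul_of_nonneg_left (pow_le_pow_left₀ hlog0 hlog 5) hM₅0.le
      _ = 32 * M₅ * L9 ^ 5 := by ring
  -- the sum of `G d / d`
  have hGsum : ∑ d ∈ Finset.Icc 1 dmax, G d / d =
      Cp * ell D ^ k * Y * ∑ d ∈ Finset.Icc 1 dmax, MeanSquareMajorant.tau 5 d / d := by
    rw [Finset.mul_sum]
    exact Finset.sum_congr rfl fun d _ => by rw [hG]; ring
  have hτsum0 : 0 ≤ ∑ d ∈ Finset.Icc 1 dmax, MeanSquareMajorant.tau 5 d / d :=
    Finset.sum_nonneg fun d _ => div_nonneg (MeanSquareMajorant.tau_nonneg 5 d) (Nat.cast_nonneg d)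
  -- `D^{1/8}·D^{-1/2} = D^{-3/8}`
  have hrpow : (D : ℝ) ^ (1 / 8 : ℝ) * (D : ℝ) ^ (-(1 / 2 : ℝ)) = (D : ℝ) ^ (-(3 / 8 : ℝ)) := by
    rw [← Real.rpow_add hD0]; norm_num
  have hI0 : (0 : ℝ) ≤ ((Nat.log 2 X : ℕ) + 1 : ℝ) := by positivity
  have hlogc0 : 0 ≤ 1 + Real.log ((⌈P⌉₊ : ℕ) : ℝ) := by
    have := Real.log_natCast_nonneg ⌈P⌉₊; linarith
  -- the arithmetic of the final bound
  have harith : (D : ℝ) * ((Nat.log 2 X : ℕ) + 1 : ℝ) * (1 + Real.log P) ^ 2 *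
        (1 + Real.log ((⌈P⌉₊ : ℕ) : ℝ)) * ∑ d ∈ Finset.Icc 1 dmax, G d / d ≤
      3840 * Cp * M₅ * K * P ^ 2 * (D : ℝ) ^ (-(3 / 8 : ℝ)) := by
    calc (D : ℝ) * ((Nat.log 2 X : ℕ) + 1 : ℝ) * (1 + Real.log P) ^ 2 *
          (1 + Real.log ((⌈P⌉₊ : ℕ) : ℝ)) * ∑ d ∈ Finset.Icc 1 dmax, G d / d
        = (((Nat.log 2 X : ℕ) + 1 : ℝ) * (1 + Real.log P) ^ 2 * (1 + Real.log ((⌈P⌉₊ : ℕ) : ℝ))) *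
            (Cp * ell D ^ k) * ((D : ℝ) * Y) *
            ∑ d ∈ Finset.Icc 1 dmax, MeanSquareMajorant.tau 5 d / d := by
          rw [hGsum]; ring
      _ ≤ ((5 * L9) * (4 * L9 ^ 2) * (3 * L9)) * (Cp * ell D ^ k) *
            (2 * P ^ 2 * (D : ℝ) ^ (-(1 / 2 : ℝ))) * (32 * M₅ * L9 ^ 5) := by
          gcongr
      _ = 3840 * Cp * M₅ * (ell D ^ (k + 81)) * P ^ 2 * (D : ℝ) ^ (-(1 / 2 : ℝ)) := by
          rw [hL9]; ring
      _ ≤ 3840 * Cp * M₅ * (K * (D : ℝ) ^ (1 / 8 : ℝ)) * P ^ 2 * (D : ℝ) ^ (-(1 / 2 : ℝ)) := by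
          gcongr
      _ = 3840 * Cp * M₅ * K * P ^ 2 * ((D : ℝ) ^ (1 / 8 : ℝ) * (D : ℝ) ^ (-(1 / 2 : ℝ))) := by ring
      _ = 3840 * Cp * M₅ * K * P ^ 2 * (D : ℝ) ^ (-(3 / 8 : ℝ)) := by rw [hrpow]
  -- the per-block hypothesis in the generic form
  have hblock' : ∀ (d h : ℕ) (R : ℝ), d ∈ Finset.Icc 1 dmax → 0 < h → ((D ^ 3 : ℕ) : ℝ) ≤ R →
      R < X → (h : ℝ) * R < P → R ^ (-(3 / 2 : ℝ)) * ∑ r ∈ dyadic R, V d h r ≤ G d * h := by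
    intro d h R hd hh hRlo hRX hhR
    rw [Finset.mem_Icc] at hd
    have hd0 : 0 < d := hd.1
    have hd2 : (d : ℝ) ≤ 2 * P4 D :=
      le_trans (by exact_mod_cast hd.2) (Nat.floor_le (by positivity))
    have hRlo' : (D : ℝ) ^ 3 ≤ R := by push_cast at hRlo; exact hRlo
    have hR0 : 0 < R := lt_of_lt_of_le (by positivity) hRlo'
    have hRhi : R ≤ 3 * (D : ℝ) * P4 D := by linarith only [hXle, hRX, hDP4]
    have hb := hblk d h R hd0 hd2 hh hRlo' hRhi hhR
    have hτ0 : 0 ≤ MeanSquareMajorant.tau 5 d := MeanSquareMajorant.tau_nonneg 5 d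
    have hh0 : (0 : ℝ) ≤ h := Nat.cast_nonneg h
    -- `R^{1/2} ≤ (3DP₄)^{1/2}`, `R^{-1/2} ≤ (D³)^{-1/2}`
    have hRY : R ^ (1 / 2 : ℝ) * P ^ (3 / 2 : ℝ) + R ^ (-(1 / 2 : ℝ)) * P ^ 2 ≤ Y := by
      have h1 : R ^ (1 / 2 : ℝ) ≤ (3 * (D : ℝ) * P4 D) ^ (1 / 2 : ℝ) :=
        Real.rpow_le_rpow hR0.le hRhi (by norm_num)
      have h2 : R ^ (-(1 / 2 : ℝ)) ≤ ((D : ℝ) ^ 3) ^ (-(1 / 2 : ℝ)) :=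
        Real.rpow_le_rpow_of_nonpos (by positivity) hRlo' (by norm_num)
      rw [hY]
      gcongr
    calc R ^ (-(3 / 2 : ℝ)) * ∑ r ∈ dyadic R, V d h r
        ≤ C * MeanSquareMajorant.tau 5 d * h * ell D ^ k *
            (R ^ (1 / 2 : ℝ) * P ^ (3 / 2 : ℝ) + R ^ (-(1 / 2 : ℝ)) * P ^ 2) := hb
      _ ≤ Cp * MeanSquareMajorant.tau 5 d * h * ell D ^ k *
            (R ^ (1 / 2 : ℝ) * P ^ (3 / 2 : ℝ) + R ^ (-(1 / 2 : ℝ)) * P ^ 2) := by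
          gcongr
      _ ≤ Cp * MeanSquareMajorant.tau 5 d * h * ell D ^ k * Y := by gcongr
      _ = G d * h := by rw [hG]; ring
  -- the generic aggregation
  have hcore := sum_largeR_le_of_blocks (A := D ^ 3) (X := X) (dmax := dmax) hA0 (P := P)
    (N := (D : ℝ)) hP1 hD0.le V hV0 Hs hHsub' G hG0 hblock'
  exact hcore.trans harith

/-- **(14.8), large-conductor leg, from the per-block large-sieve bounds (β = 0, the typed node).**
Suppose that for every `B` there are `k`, `C` such that, for all large `D` under (A), for every `κ*`
with (14.1) and all `1 ≤ d ≤ 2P₄`, `h ≥ 1`, `D³ ≤ R ≤ 3DP₄` with `hR < P`, the §7.u041-type block bound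
`R^{−3/2} Σ_{R≤r<2R} Σ*_{θ mod r, θχ non-principal} |Σ_{(l,h)=1} κ*(dl)θ(l) Σ_{p∼P} χθ̄(p)Δ(l/(phr))|
 ≤ C·τ₅(d)·h·𝓛ᵏ·(R^{1/2}P^{3/2} + R^{−1/2}P²)` holds ("Mellin transform, Lemma 5.4 (i) and the
large sieve inequality … in a way similar to the proof of Proposition 7.1"). Then the `D³ ≤ r < 2DP₄`
part of the u017 majorant is `≤ C'·P²·D^{−3/8}` for all large `D`: `Typed.Sec14.Eq148leg2` holds.
[cite: Zhang2022LandauSiegel, §14 (14.8) p.79, tex L3956–L3963] -/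
theorem eq148leg2_of_blocks
    (hblock : ∀ B : ℝ, ∃ k : ℕ, ∃ C : ℝ, ForAllLarge fun D _ χ => AssumptionA D χ →
      ∀ κs : ℕ → ℂ, Eq141 B κs → ∀ (d h : ℕ) (R : ℝ), 0 < d → (d : ℝ) ≤ 2 * P4 D → 0 < h →
        (D : ℝ) ^ 3 ≤ R → R ≤ 3 * (D : ℝ) * P4 D → (h : ℝ) * R < bigP D →
        R ^ (-(3 / 2 : ℝ)) * ∑ r ∈ dyadic R,
            ∑ θ ∈ finsetOf {θ : DirichletCharacter ℂ r | θ.IsPrimitive ∧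
                DirichletCharacter.changeLevel (dvd_mul_left r D) θ ≠
                  DirichletCharacter.changeLevel (dvd_mul_right D r) χ},
              ‖∑' l : ℕ, if Nat.Coprime l h then
                  κs (d * l) * θ (l : ZMod r) *
                    ∑ p ∈ primeWindow D, χ (p : ZMod D) * θ⁻¹ (p : ZMod r) *
                      DeltaW D ((l : ℝ) / ((p : ℝ) * h * r)) else 0‖ ≤
          C * MeanSquareMajorant.tau 5 d * h * ell D ^ k *
            (R ^ (1 / 2 : ℝ) * bigP D ^ (3 / 2 : ℝ) + R ^ (-(1 / 2 : ℝ)) * bigP D ^ 2)) :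
    Eq148leg2 := by
  intro B
  obtain ⟨k, C, D₀, hbl⟩ := hblock B
  obtain ⟨K, -, hK⟩ := ell_pow_le_mul_rpow_eighth (k + 81)
  obtain ⟨D₁, hD₁⟩ := sq_mul_sqrt_three_t0_le_bigT
  obtain ⟨D₂, hD₂⟩ := exists_nat_forall_le_ell 3
  refine ⟨3 / 8, by norm_num, 3840 * max C 0 * MeanSquareMajorant.majorantConst 5 5 * K,
    max D₀ (max D₁ D₂), fun D _ χ hD hq hp hA κs as hκ _ => ?_⟩
  have hDD₀ : D₀ ≤ D := le_trans (le_max_left _ _) hD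
  have hDD₁ : D₁ ≤ D := le_trans (le_trans (le_max_left _ _) (le_max_right _ _)) hD
  have hDD₂ : D₂ ≤ D := le_trans (le_trans (le_max_right _ _) (le_max_right _ _)) hD
  have hL3 : 3 ≤ ell D := hD₂ D hDD₂
  have hD1nat : 1 ≤ D := by
    by_contra h0
    push Not at h0
    have : D = 0 := by omega
    have : ell D = 0 := by rw [ell, this, Nat.cast_zero, Real.log_zero]
    linarith
  have hP40 : 0 ≤ P4 D := zero_le_one.trans (one_le_P4_of_three_le hL3)
  have hX1 : 1 ≤ ⌈2 * (D : ℝ) * P4 D⌉₊ := by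
    have h1 : 1 ≤ P4 D := one_le_P4_of_three_le hL3
    have hD1 : (1 : ℝ) ≤ D := by exact_mod_cast hD1nat
    refine Nat.one_le_iff_ne_zero.mpr (Nat.ceil_pos.mpr ?_).ne'
    nlinarith
  have hXle : ((⌈2 * (D : ℝ) * P4 D⌉₊ : ℕ) : ℝ) ≤ 2 * (D : ℝ) * P4 D + 1 :=
    (Nat.ceil_lt_add_one (by positivity)).le
  exact largeR_sum_le_of_blocks hL3 (hD₁ D hDD₁) (hK D hD1nat)
    (fun d h r => ∑ θ ∈ finsetOf {θ : DirichletCharacter ℂ r | θ.IsPrimitive ∧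
        DirichletCharacter.changeLevel (dvd_mul_left r D) θ ≠
          DirichletCharacter.changeLevel (dvd_mul_right D r) χ},
      ‖∑' l : ℕ, if Nat.Coprime l h then
          κs (d * l) * θ (l : ZMod r) *
            ∑ p ∈ primeWindow D, χ (p : ZMod D) * θ⁻¹ (p : ZMod r) *
              DeltaW D ((l : ℝ) / ((p : ℝ) * h * r)) else 0‖)
    (fun d h r => Finset.sum_nonneg fun _ _ => norm_nonneg _) hX1 hXle
    (fun r => (Finset.Ico 1 ⌈bigP D / r⌉₊).filter (fun h => D / Nat.gcd D r ∣ h))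
    (fun r => Finset.filter_subset _ _) (hbl D χ hDD₀ hq hp hA κs hκ)

/-- **(14.8), large-conductor leg, β-TWISTED form** (the shape wanted by the general-β assembly of
Proposition 14.1, `Section14Prop141Twisted`: weight `(pt₀)^β` inside the `p`-sum, `r`-range
`Icc 2 ⌊2DP₄⌋`). From the twisted per-block bounds (uniform in `‖β‖ < 5α`) the `D³ ≤ r ≤ 2DP₄` part of
the twisted u017 majorant `rhs1417OnW` is `≤ C'·P²·D^{−3/8}` for all large `D`.
[cite: Zhang2022LandauSiegel, §14 (14.8) p.79, tex L3956–L3963; p.76 tex L3849 ("almost identical")] -/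
theorem rhs1417OnW_largeR_le_of_blocks
    (hblock : ∀ B : ℝ, ∃ k : ℕ, ∃ C : ℝ, ForAllLarge fun D _ χ => AssumptionA D χ →
      ∀ β : ℂ, ‖β‖ < 5 * alpha D → ∀ κs : ℕ → ℂ, Eq141 B κs →
      ∀ (d h : ℕ) (R : ℝ), 0 < d → (d : ℝ) ≤ 2 * P4 D → 0 < h →
        (D : ℝ) ^ 3 ≤ R → R ≤ 3 * (D : ℝ) * P4 D → (h : ℝ) * R < bigP D →
        R ^ (-(3 / 2 : ℝ)) * ∑ r ∈ dyadic R,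
            ∑ θ ∈ finsetOf {θ : DirichletCharacter ℂ r | θ.IsPrimitive ∧
                DirichletCharacter.changeLevel (dvd_mul_left r D) θ ≠
                  DirichletCharacter.changeLevel (dvd_mul_right D r) χ},
              ‖∑' l : ℕ, if Nat.Coprime l h then
                  κs (d * l) * θ (l : ZMod r) *
                    ∑ p ∈ primeWindow D, χ (p : ZMod D) * θ⁻¹ (p : ZMod r) * wt D β p *
                      DeltaW D ((l : ℝ) / ((p : ℝ) * h * r)) else 0‖ ≤
          C * MeanSquareMajorant.tau 5 d * h * ell D ^ k *
            (R ^ (1 / 2 : ℝ) * bigP D ^ (3 / 2 : ℝ) + R ^ (-(1 / 2 : ℝ)) * bigP D ^ 2)) :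
    ∀ B : ℝ, ∃ c : ℝ, 0 < c ∧ ∃ C : ℝ, ForAllLarge fun D _ χ => AssumptionA D χ →
      ∀ β : ℂ, ‖β‖ < 5 * alpha D → ∀ κs as : ℕ → ℂ, Eq141 B κs → Eq142 D B as →
        rhs1417OnW χ β κs ((Finset.Icc 2 ⌊2 * (D : ℝ) * P4 D⌋₊).filter (fun r => ¬ r < D ^ 3))
          ≤ C * bigP D ^ 2 * (D : ℝ) ^ (-c) := by
  intro B
  obtain ⟨k, C, D₀, hbl⟩ := hblock B
  obtain ⟨K, -, hK⟩ := ell_pow_le_mul_rpow_eighth (k + 81)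
  obtain ⟨D₁, hD₁⟩ := sq_mul_sqrt_three_t0_le_bigT
  obtain ⟨D₂, hD₂⟩ := exists_nat_forall_le_ell 3
  refine ⟨3 / 8, by norm_num, 3840 * max C 0 * MeanSquareMajorant.majorantConst 5 5 * K,
    max D₀ (max D₁ D₂), fun D _ χ hD hq hp hA β hβ κs as hκ _ => ?_⟩
  have hDD₀ : D₀ ≤ D := le_trans (le_max_left _ _) hD
  have hDD₁ : D₁ ≤ D := le_trans (le_trans (le_max_left _ _) (le_max_right _ _)) hD
  have hDD₂ : D₂ ≤ D := le_trans (le_trans (le_max_right _ _) (le_max_right _ _)) hD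
  have hL3 : 3 ≤ ell D := hD₂ D hDD₂
  have hD1nat : 1 ≤ D := by
    by_contra h0
    push Not at h0
    have : D = 0 := by omega
    have : ell D = 0 := by rw [ell, this, Nat.cast_zero, Real.log_zero]
    linarith
  have hP40 : 0 ≤ P4 D := zero_le_one.trans (one_le_P4_of_three_le hL3)
  have hX1 : 1 ≤ ⌊2 * (D : ℝ) * P4 D⌋₊ + 1 := by omega
  have hXle : ((⌊2 * (D : ℝ) * P4 D⌋₊ + 1 : ℕ) : ℝ) ≤ 2 * (D : ℝ) * P4 D + 1 := by
    push_cast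
    linarith [Nat.floor_le (show 0 ≤ 2 * (D : ℝ) * P4 D by positivity)]
  have hIcc : (Finset.Icc 2 ⌊2 * (D : ℝ) * P4 D⌋₊).filter (fun r => ¬ r < D ^ 3) =
      (Finset.Ico 2 (⌊2 * (D : ℝ) * P4 D⌋₊ + 1)).filter (fun r => ¬ r < D ^ 3) := by
    rw [Finset.Ico_add_one_right_eq_Icc]
  rw [hIcc]
  exact largeR_sum_le_of_blocks hL3 (hD₁ D hDD₁) (hK D hD1nat)
    (fun d h r => ∑ θ ∈ finsetOf {θ : DirichletCharacter ℂ r | θ.IsPrimitive ∧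
        DirichletCharacter.changeLevel (dvd_mul_left r D) θ ≠
          DirichletCharacter.changeLevel (dvd_mul_right D r) χ},
      ‖∑' l : ℕ, if Nat.Coprime l h then
          κs (d * l) * θ (l : ZMod r) *
            ∑ p ∈ primeWindow D, χ (p : ZMod D) * θ⁻¹ (p : ZMod r) * wt D β p *
              DeltaW D ((l : ℝ) / ((p : ℝ) * h * r)) else 0‖)
    (fun d h r => Finset.sum_nonneg fun _ _ => norm_nonneg _) hX1 hXle
    (fun r => (Finset.Ico 1 ⌈bigP D / r⌉₊).filter (fun h => D / Nat.gcd D r ∣ h))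
    (fun r => Finset.filter_subset _ _) (hbl D χ hDD₀ hq hp hA β hβ κs hκ)

end Literature.NumberTheory.LFunctions.Zhang2022.Typed.Sec14
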